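import Summits.Parity.GeneralizedHardyLittlewood.Theorems.LeeYangFibresRelativeDimOneSplitDefs
import Summits.Parity.GeneralizedHardyLittlewood.Theorems.LeeYangFibresRelativeDimOneLocalAverage
import Literature.NumberTheory.Sieve.LinearEquationsInPrimesProofs
import Literature.NumberTheory.Sieve.LinearEquationsInPrimesOneForm
import Literature.NumberTheory.Sieve.LinearEquationsInPrimesSingularSeries
import Literature.NumberTheory.Sieve.GallagherSingularSeries
import HarnessLib

/-!
# Coset singular means I: exact local averages of the local factors of `ψ_i(n) = a_i n + b_i`
(crux stmt-Parity-14113 `LeeYangFibres.RelativeDimOne`, line gallagher-backwards-split, stub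
`stub_cosetSingularMean`, infrastructure file 1 of 3)

For the `d = 1` systems `sys a b` (`ψ_i(n) = a_i n + b_i`) of the line vocabulary
`LeeYangFibresRelativeDimOneSplitDefs` we prove the exact identities behind Gallagher's averaging of
singular series over the shift vectors `b`:

* `localFactor_sys_congr`: `β_m(sys a b)` depends only on `b mod m` (coordinatewise);
* `isNondegenerateSystem_sys`, `exists_crossDisc_eq_zero`: `sys a b` (all `a_i ≠ 0`) is degenerate only
  if some cross-discriminant `a_i b_j − a_j b_i` (`i ≠ j`) vanishes;
* `sum_localFactor_sys_range`: for a prime `p` and ANY `a, e`,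
  `∑_{x ∈ [0,p)^t} β_p(sys a (e + x)) = p^t` — the local factors average to EXACTLY one over the shifts
  (form by form: `∑_{v < p} Λ_p(z + v) = p`, `sum_localVonMangoldt_add`);
* `sum_prod_localFactor_sys` (registered auxiliary theorem): the Chinese-remainder product version over a
  finite set `S` of primes with product `P`: `∑_{x ∈ [0,P)^t} ∏_{p ∈ S} β_p(sys a (e + x)) = P^t`;
* `sum_piFinset_Ico_of_periodic'`: Gallagher's block summation of an `n`-periodic function over a box
  `∏_j [a_j, a_j + m_j n) ⊆ ℕ^t` with coordinate-dependent side lengths.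

All statements are exact identities; the proofs follow `LeeYangFibresRelativeDimOneLocalAverage`
(translate-constellations) and `Literature.NumberTheory.Sieve.GallagherSingularSeries`.

References: P. X. Gallagher, Mathematika 23 (1976), §2 [Gallagher1976]; B. Green, T. Tao, Ann. of Math.
171 (2010), (1.6) [GreenTao2010].
-/

noncomputable section

open scoped BigOperators Classical
open Finset Literature.NumberTheory.Sieve

namespace Summit.Parity.GeneralizedHardyLittlewood.Cruxes.RelativeDimOne.GallagherBackwardsSplit

namespace CosetMeanProof

open TranslateAmplification (localFactor_fin_one)

variable {t : ℕ}

/-! ### The systems `sys a b` -/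

/-- Values of the forms of `sys a b`: `ψ_i(n) = a_i n + b_i`. -/
theorem sys_eval (a b : Fin t → ℤ) (i : Fin t) (n : Fin 1 → ℤ) :
    (sys a b i).eval n = a i * n 0 + b i := by
  simp [sys, AffLinForm.eval]

/-- The local factor of `sys a b` at ANY modulus `m` depends only on the shifts `b_i` modulo `m`
(the integrand `∏_i Λ_m(a_i n + b_i)` of `β_m` does). -/
theorem localFactor_sys_congr {m : ℕ} (a : Fin t → ℤ) {b b' : Fin t → ℤ}
    (h : ∀ i, b i ≡ b' i [ZMOD m]) : localFactor (sys a b) m = localFactor (sys a b') m := by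
  rw [localFactor_fin_one, localFactor_fin_one]
  congr 1
  refine Finset.sum_congr rfl fun c _ => Finset.prod_congr rfl fun i _ => ?_
  have he : (sys a b i).eval (fun _ => (c : ℤ)) ≡ (sys a b' i).eval (fun _ => (c : ℤ)) [ZMOD m] := by
    rw [sys_eval, sys_eval]
    exact (h i).add_left _
  unfold localVonMangoldt
  rw [← Int.gcd_emod, he.eq, Int.gcd_emod]

/-- Non-degeneracy criterion: if all `a_i ≠ 0` and all cross-discriminants `a_i b_j − a_j b_i`
(`i ≠ j`) are non-zero, then `sys a b` is non-degenerate (a proportionality `λ ψ_i = μ ψ_j` gives,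
at `n = 0, 1`, `λ b_i = μ b_j`, `λ a_i = μ a_j`, whence `λ (a_i b_j − a_j b_i) = 0`). -/
theorem isNondegenerateSystem_sys {a b : Fin t → ℤ} (ha : ∀ i, a i ≠ 0)
    (hD : ∀ i j, i ≠ j → a i * b j ≠ a j * b i) : IsNondegenerateSystem (sys a b) := by
  refine ⟨fun i h0 => ha i ?_, fun i j hij la mu hlm => ?_⟩
  · have := congr_fun h0 (0 : Fin 1)
    simpa [sys] using this
  · have e0 := hlm 0
    have e1 := hlm fun _ => 1
    simp only [sys_eval, Pi.zero_apply, mul_zero, zero_add, mul_one] at e0 e1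
    have e2 : la * a i = mu * a j := by linear_combination e1 - e0
    have hla : la = 0 := by
      by_contra hla
      refine hD i j hij (mul_left_cancel₀ hla ?_)
      linear_combination (b j) * e2 - (a j) * e0
    refine ⟨hla, ?_⟩
    rw [hla, zero_mul] at e2
    rcases mul_eq_zero.mp e2.symm with h | h
    · exact h
    · exact absurd h (ha j)

/-- A DEGENERATE `sys a b` with all `a_i ≠ 0` has a vanishing cross-discriminant
`a_i b_j = a_j b_i` for some `i ≠ j`. -/
theorem exists_crossDisc_eq_zero {a b : Fin t → ℤ} (ha : ∀ i, a i ≠ 0)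
    (h : ¬ IsNondegenerateSystem (sys a b)) : ∃ i j, i ≠ j ∧ a i * b j = a j * b i := by
  by_contra hc
  push Not at hc
  exact h (isNondegenerateSystem_sys ha fun i j hij => hc i j hij)

/-! ### Exact local averages -/

/-- ONE FORM: `∑_{v < p} Λ_p(z + v) = p` for a prime `p` (exactly one excluded residue; this is
`p · β_p = p` for the single form `n ↦ n + z`, `OneForm.localFactor_eq`). -/
theorem sum_localVonMangoldt_add (z : ℤ) {p : ℕ} (hp : p.Prime) :
    ∑ v ∈ range p, localVonMangoldt p (z + v) = p := by
  let Φ : Fin 1 → AffLinForm 1 := fun _ => ⟨fun _ => 1, z⟩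
  have hnd : ¬ ((p : ℤ) ∣ (Φ 0).coeff 0) := by
    show ¬ ((p : ℤ) ∣ ((1 : ℕ) : ℤ))
    rw [Int.natCast_dvd_natCast, Nat.dvd_one]
    exact hp.one_lt.ne'
  have h1 : localFactor Φ p = 1 := by
    rw [OneForm.localFactor_eq Φ hp, if_neg hnd]
  have h2 := localFactor_fin_one Φ p
  have h3 : ∀ c : ℕ, ∏ i : Fin 1, localVonMangoldt p ((Φ i).eval fun _ => (c : ℤ)) =
      localVonMangoldt p (z + c) := by
    intro c
    rw [Fin.prod_univ_one]
    congr 1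
    simp only [AffLinForm.eval, Fin.sum_univ_one, Φ]
    ring
  simp_rw [h3] at h2
  rw [h1, eq_comm, inv_mul_eq_iff_eq_mul₀ (by exact_mod_cast hp.ne_zero : (p : ℝ) ≠ 0), mul_one] at h2
  exact h2

/-- `t` FORMS AT A PRIME (Gallagher's exact local average for `ψ_i(n) = a_i n + b_i`): for a prime `p`
and ANY coefficient vector `a` and base point `e`,
`∑_{x ∈ [0,p)^t} β_p(sys a (e + x)) = p^t`, i.e. `𝔼_{b mod p} β_p(a, b) = 1`
(write `β_p = p⁻¹ ∑_{c mod p} ∏_i Λ_p(a_i c + b_i)` and sum each `b_i` over a full residue system). -/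
theorem sum_localFactor_sys_range (a e : Fin t → ℤ) {p : ℕ} (hp : p.Prime) :
    ∑ x ∈ Fintype.piFinset (fun _ : Fin t => range p),
        localFactor (sys a (fun i => e i + (x i : ℤ))) p = (p : ℝ) ^ t := by
  have hp0 : (p : ℝ) ≠ 0 := by exact_mod_cast hp.ne_zero
  have key : ∀ x : Fin t → ℕ, localFactor (sys a (fun i => e i + (x i : ℤ))) p =
      (p : ℝ)⁻¹ * ∑ c ∈ range p, ∏ i, localVonMangoldt p ((a i * c + e i) + (x i : ℤ)) := by
    intro x
    rw [localFactor_fin_one]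
    congr 1
    refine Finset.sum_congr rfl fun c _ => Finset.prod_congr rfl fun i _ => ?_
    rw [sys_eval]
    congr 1
    ring
  simp_rw [key]
  rw [← Finset.mul_sum, Finset.sum_comm]
  have hinner : ∀ c ∈ range p, ∑ x ∈ Fintype.piFinset (fun _ : Fin t => range p),
      ∏ i, localVonMangoldt p ((a i * c + e i) + (x i : ℤ)) = (p : ℝ) ^ t := by
    intro c _
    rw [← Finset.prod_univ_sum (fun _ : Fin t => range p)
      (fun i v => localVonMangoldt p ((a i * c + e i) + (v : ℤ)))]
    simp_rw [sum_localVonMangoldt_add _ hp]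
    rw [Finset.prod_const, Finset.card_univ, Fintype.card_fin]
  rw [Finset.sum_congr rfl hinner, Finset.sum_const, Finset.card_range, nsmul_eq_mul,
    inv_mul_cancel_left₀ hp0]

/-- Periodicity in Gallagher's form: `β_p(sys a (e + x))`, `x ∈ ℕ^t`, is unchanged under
`x ↦ x mod n` whenever `p ∣ n`. -/
theorem localFactor_sys_modVec (a e : Fin t → ℤ) {p n : ℕ} (hpn : p ∣ n) (x : Fin t → ℕ) :
    localFactor (sys a (fun i => e i + ((Gallagher.modVec n x i : ℕ) : ℤ))) p =
      localFactor (sys a (fun i => e i + (x i : ℤ))) p := by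
  refine localFactor_sys_congr a fun i => Int.ModEq.add_left _ ?_
  rw [Gallagher.modVec_apply, Int.natCast_emod]
  exact (Int.mod_modEq _ _).of_dvd (Int.natCast_dvd_natCast.2 hpn)

/-- CHINESE REMAINDER THEOREM OVER `S`: for a finite set `S` of primes with product `P` and any `a, e`,
`∑_{x ∈ [0,P)^t} ∏_{p ∈ S} β_p(sys a (e + x)) = P^t` (induction on `S`; the fibres of reduction
modulo `∏ S'` are handled by `Gallagher.sum_filter_modVec_eq`). -/
theorem sum_prod_localFactor_sys' (a e : Fin t → ℤ) (S : Finset ℕ) (hS : ∀ p ∈ S, p.Prime) :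
    ∑ x ∈ Fintype.piFinset (fun _ : Fin t => range (∏ p ∈ S, p)),
        ∏ p ∈ S, localFactor (sys a (fun i => e i + (x i : ℤ))) p =
      ((∏ p ∈ S, p : ℕ) : ℝ) ^ t := by
  induction S using Finset.induction_on with
  | empty =>
    simp
  | insert p S hpS ih =>
    have hp : p.Prime := hS p (mem_insert_self _ _)
    have hS' : ∀ q ∈ S, q.Prime := fun q hq => hS q (mem_insert_of_mem hq)
    have ih' := ih hS'
    have hP'pos : 0 < ∏ q ∈ S, q := Finset.prod_pos fun q hq => (hS' q hq).pos
    have hcop : Nat.Coprime p (∏ q ∈ S, q) :=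
      Nat.Coprime.prod_right fun q hq =>
        (Nat.coprime_primes hp (hS' q hq)).2 fun h => hpS (h ▸ hq)
    rw [Finset.prod_insert hpS]
    simp_rw [Finset.prod_insert hpS]
    have hmaps : ∀ r ∈ Fintype.piFinset (fun _ : Fin t => range (p * ∏ q ∈ S, q)),
        Gallagher.modVec (∏ q ∈ S, q) r ∈
          Fintype.piFinset (fun _ : Fin t => range (∏ q ∈ S, q)) :=
      fun r _ => Fintype.mem_piFinset.2 fun j => mem_range.2 (Nat.mod_lt _ hP'pos)
    rw [← Finset.sum_fiberwise_of_maps_to hmaps]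
    have hinner : ∀ u ∈ Fintype.piFinset (fun _ : Fin t => range (∏ q ∈ S, q)),
        ∑ r ∈ (Fintype.piFinset fun _ : Fin t => range (p * ∏ q ∈ S, q)).filter
            (fun r => Gallagher.modVec (∏ q ∈ S, q) r = u),
          localFactor (sys a (fun i => e i + (r i : ℤ))) p *
            ∏ q ∈ S, localFactor (sys a (fun i => e i + (r i : ℤ))) q =
          (p : ℝ) ^ t * ∏ q ∈ S, localFactor (sys a (fun i => e i + (u i : ℤ))) q := by
      intro u hu
      have hF : ∀ r ∈ (Fintype.piFinset fun _ : Fin t => range (p * ∏ q ∈ S, q)).filter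
          (fun r => Gallagher.modVec (∏ q ∈ S, q) r = u),
          ∏ q ∈ S, localFactor (sys a (fun i => e i + (r i : ℤ))) q =
            ∏ q ∈ S, localFactor (sys a (fun i => e i + (u i : ℤ))) q := by
        intro r hr
        rw [← (mem_filter.1 hr).2]
        exact Finset.prod_congr rfl fun q hq =>
          (localFactor_sys_modVec a e
            (Finset.dvd_prod_of_mem (fun i : ℕ => i) hq : q ∣ ∏ i ∈ S, i) r).symm
      rw [Finset.sum_congr rfl fun r hr => by rw [hF r hr], ← Finset.sum_mul,
        Gallagher.sum_filter_modVec_eq hp.pos hP'pos hcop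
          (fun r : Fin t → ℕ => localFactor (sys a (fun i => e i + (r i : ℤ))) p)
          (fun r => localFactor_sys_modVec a e (dvd_refl p) r) hu,
        sum_localFactor_sys_range a e hp]
    rw [Finset.sum_congr rfl hinner, ← Finset.mul_sum, ih', Nat.cast_mul, mul_pow]

/-! ### Gallagher's block summation with coordinate-dependent side lengths -/

/-- The fibre of componentwise reduction over a box `∏_j I_j ⊆ ℕ^t` is the box of the one-dimensional
fibres. -/
theorem filter_piFinset_modVec_eq' {k : ℕ} (I : Fin k → Finset ℕ) (n : ℕ) (u : Fin k → ℕ) :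
    (Fintype.piFinset I).filter (fun x => Gallagher.modVec n x = u) =
      Fintype.piFinset fun j => (I j).filter fun y => y % n = u j := by
  ext x
  simp only [mem_filter, Fintype.mem_piFinset, funext_iff, Gallagher.modVec_apply]
  exact ⟨fun h j => ⟨h.1 j, h.2 j⟩, fun h => ⟨fun j => (h j).1, fun j => (h j).2⟩⟩

/-- Each residue tuple `u ∈ [0, n)^k` has exactly `∏_j m_j` lifts in the box `∏_j [a_j, a_j + m_j n)`. -/
theorem card_filter_piFinset_modVec' {k n : ℕ} (hn : 0 < n) (a m : Fin k → ℕ) {u : Fin k → ℕ}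
    (hu : u ∈ Fintype.piFinset fun _ : Fin k => range n) :
    #((Fintype.piFinset fun j => Ico (a j) (a j + m j * n)).filter
        (fun x => Gallagher.modVec n x = u)) = ∏ j, m j := by
  rw [filter_piFinset_modVec_eq', Fintype.card_piFinset]
  exact Finset.prod_congr rfl fun j _ =>
    Gallagher.card_filter_Ico_mod_eq (a := a j) (m := m j) hn (mem_range.1 (Fintype.mem_piFinset.1 hu j))

/-- BLOCK SUMMATION: the sum of an `n`-periodic function over the box `∏_j [a_j, a_j + m_j n) ⊆ ℕ^k` is
`∏_j m_j` times its sum over one period `[0, n)^k`. -/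
theorem sum_piFinset_Ico_of_periodic' {k n : ℕ} (hn : 0 < n) (a m : Fin k → ℕ) (f : (Fin k → ℕ) → ℝ)
    (hf : ∀ x, f (Gallagher.modVec n x) = f x) :
    ∑ x ∈ Fintype.piFinset (fun j => Ico (a j) (a j + m j * n)), f x =
      (∏ j, (m j : ℝ)) * ∑ u ∈ Fintype.piFinset (fun _ : Fin k => range n), f u := by
  have hmaps : ∀ x ∈ Fintype.piFinset (fun j => Ico (a j) (a j + m j * n)),
      Gallagher.modVec n x ∈ Fintype.piFinset (fun _ : Fin k => range n) :=
    fun x _ => Fintype.mem_piFinset.2 fun j => mem_range.2 (Nat.mod_lt _ hn)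
  rw [← Finset.sum_fiberwise_of_maps_to hmaps, Finset.mul_sum]
  refine Finset.sum_congr rfl fun u hu => ?_
  have hval : ∀ x ∈ (Fintype.piFinset fun j => Ico (a j) (a j + m j * n)).filter
      (fun x => Gallagher.modVec n x = u), f x = f u := by
    intro x hx
    rw [← hf x, (mem_filter.1 hx).2]
  rw [Finset.sum_congr rfl hval, Finset.sum_const, nsmul_eq_mul, card_filter_piFinset_modVec' hn a m hu]
  push_cast
  ring

end CosetMeanProof

open CosetMeanProof in
/-- **Registered auxiliary theorem** (infrastructure for `stub_cosetSingularMean`): EXACT LOCAL AVERAGES of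
the Hardy–Littlewood local factors of `ψ_i(n) = a_i n + b_i` over the shifts. For a finite set `S` of
primes with product `P` and any coefficient vector `a` and base point `e`,
`∑_{x ∈ [0,P)^t} ∏_{p ∈ S} β_p(sys a (e + x)) = P^t` (Gallagher 1976, §2: `𝔼_b β_p(a,b) = 1` exactly,
and the factors at distinct primes are independent by the Chinese remainder theorem). -/
theorem sum_prod_localFactor_sys : ∀ {t : ℕ} (a e : Fin t → ℤ) (S : Finset ℕ), (∀ p ∈ S, p.Prime) → ∑ x ∈ Fintype.piFinset (fun _ : Fin t => Finset.range (∏ p ∈ S, p)), ∏ p ∈ S, localFactor (sys a (fun i => e i + (x i : ℤ))) p = ((∏ p ∈ S, p : ℕ) : ℝ) ^ t :=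
  fun a e S hS => sum_prod_localFactor_sys' a e S hS

end Summit.Parity.GeneralizedHardyLittlewood.Cruxes.RelativeDimOne.GallagherBackwardsSplit

end
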